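import Literature.IUT.HodgeArakelov.MonoThetaProjectiveBridgeEtThFacts
import Literature.AnabelianGeometry.EtaleTheta.SettingModelTateRigidityOfRecordClosed
import Literature.AnabelianGeometry.EtaleTheta.SettingModelTateGroupLevel
import Literature.AnabelianGeometry.EtaleTheta.SettingModelTateInstance
import HarnessLib

/-!
# [IUTchII] Prop. 1.5 (i), (i)′, (ii) for the [EtTh] model family AT THE STAGE-2 (TATE-SHEAR) MODEL `modelχq` / `modelTate`:
# six binders of the model discharge are THEOREMS there — temp-slimness, openness of `aug`, the §1 origin clauses AND
# [EtTh] Prop. 1.5 (ii), (iii) (proof-only capstone; DAG nodes IUTchII:Prop1.5(i), IUTchII:Prop1.5(ii))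

S. Mochizuki, *Inter-universal Teichmüller theory II*, kurims manuscript (Dec. 2020), Prop. 1.5 (i), (ii) p. 29
[claim: Mochizuki2012, status: disputed] (IUTchII §1 Prop 1.5, kurims p.29): "(i) … Such a projective system is
uniquely determined, up to isomorphism, by `X̲̲_k` [cf. … the discrete rigidity property of [EtTh], Corollary
2.19, (ii)]. (ii) The transition morphisms … are all isomorphisms. Moreover, any isomorphism … lifts …
[cf. [EtTh], Corollary 2.18, (iv)]."; S. Mochizuki, *The étale theta function …*, Publ. RIMS **45** (2009) [EtTh],
Prop. 1.5 p. 23, Def. 2.7 p. 41, Cor. 2.18 (iv) pp. 61–63, Cor. 2.19 (ii) p. 64 (PRIMS PDF pages)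
[cite: MochizukiEtTh2009, Cor 2.19(ii) p.64].  Cell `abc-iut`, seat abc-iut-w4-d038 (gen 8), row «PROP15-AT-MODELTATE»
(R-C / K-L6 instance-witness lane).  PROOF-ONLY: no definition, no instance, no new named fact; nothing of another seat
edited or restated.

STATE OF RECORD.  abc-iut-L2-t10's `MonoThetaProjectiveBridgeEtThFacts` proves [IUTchII] Prop. 1.5 (i)′, (ii), (i) for the
model family of `X̲̲_K` built from ANY [EtTh] §1 theta setting, modulo ONE binder list; abc-iut-f-150's
`MonoThetaProjectiveBridgeEtThAtModelChi` supplies FOUR of those binders (`hslimX`, `haugOpen`, `IsEtThOrigin`, `hYcl`) at the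
stage-1 record model `modelχ p` — where, however, the binder `h15 : Prop15iii E hC` is NOT available for the section data
(abc-iut-L2-t6's stage-1 truth table `prop15_truthTable_kummerDataχSec`: (iii) fails for every `η̈`).

THIS FILE, one stage up.  §A: at the stage-2 model `D := ThetaSetting.modelχq p i j hj` (every `i`, every even `j`) the same
four binders are THEOREMS (`isSlimGroup_PiTpχq`, `isOpenMap_aug_modelχq`, `ThetaSetting.modelχq_isEtThOrigin`, `hYcl_modelχq`),
giving the (i)′ / (ii) / (i) / summary twins for EVERY étale-theta datum over `modelχq`.  §B: at the Tate instance
`modelTate p = modelχq p 1 2` and the section datum `E_s` of ANY continuous Galois section `s` carrying the class of record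
`η̈♯ = etaDdχq`, the two further binders [EtTh] Prop. 1.5 (iii) (`h15`, abc-iut-L2-t6's `prop15iii_etaleThetaDataOfClass_etaDdχq`)
and Prop. 1.5 (ii) (`h15ii`, the coordinate-kit route `prop13_prop15_sectionData_modelTate`) are THEOREMS as well, so that
for every `X̲̲`-choice `C` over `E_s` the residual list of the model discharge reads {cusp labels `L`, [EtTh] Cor. 2.18 (i)
at the chain levels, `ThetaEnvTower.Cor219_iii`} (+ the bridge's standing side conditions `hl`, `hp2`, `hpl`, `hζ` and the
data `τ`, `f`).  §C: at `s := inr` with the `X̲̲` OF RECORD (`doubleUnderlineχqOfEtaRes … (eta_res_etaDdχq …)`,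
abc-iut-L2-d1 / L2-t8) and the EMPTY cusp labelling of record, `L` leaves too: residual = {Cor. 2.18 (i) at the chain
levels, `ThetaEnvTower.Cor219_iii`}.  §0: the root-cocycle datum `f ∈ C.rootCocycles hC` is never vacuous — for EVERY
`X̲̲`-choice over EVERY setting, `rootCocycles_nonempty` (structure clause `eta_res` + `contH1_conj_one`).

HONEST LABEL: `modelχq` is a SEMI-SYNTHETIC model of the typed [EtTh] §1 interface (not the tempered `π₁` of a curve):
binder-discharge / joint-satisfiability evidence for the interface and origin binders of the [IUTchII] Prop. 1.5 model
discharge, and the kernel record that at the stage-2 inhabitant six of its binders are not assumptions; the [IUTchII] claim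
key `Mochizuki2012` is DISPUTED (D-0012) and nothing of it is asserted; nothing of [EtTh] (refereed) is asserted; no side is
taken on [IUTchIII] Cor. 3.12; typed ≠ proved.
-/

noncomputable section

namespace Literature.IUT.HodgeArakelov

open Literature.AnabelianGeometry.EtaleTheta Literature.AnabelianGeometry.EtaleTheta.SettingModel
open Literature.AnabelianGeometry.SemiGraphs
open scoped Literature.AnabelianGeometry.EtaleTheta

/-! ## §0. The root-cocycle datum is never vacuous -/

/-- **The cocycles of `η̲̈^{Θ,l·ℤ×μ₂}` EXIST for every choice `X̲̲`** over every theta setting: the distinguished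
`l·Δ_Θ`-valued lift of `η̈^Θ|_{Π^tp_Ÿ̲̲}` recorded in the structure clause `eta_res` of `X̲̲` lies in the orbit (at `σ = 1`).
Same two lines as abc-iut-L2's `thetaCocycles_nonempty`. [cite: MochizukiEtTh2009, Def 2.7 p.41] -/
theorem _root_.Literature.AnabelianGeometry.EtaleTheta.ThetaSetting.EtaleThetaData.DoubleUnderline.rootCocycles_nonempty
    {p : ℕ} [Fact p.Prime] {D : Literature.AnabelianGeometry.EtaleTheta.ThetaSetting p} {E : D.EtaleThetaData} {l : ℕ}
    (C : E.DoubleUnderline l)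
    (hC : D.Compat) : (C.rootCocycles hC).Nonempty := by
  obtain ⟨f, hf, hval, hmk⟩ := C.eta_res
  haveI := hC.GtpYdd_normal
  exact ⟨⟨f, hf⟩, hval, 1, one_mem _, by
    rw [Literature.AnabelianGeometry.EtaleTheta.ThetaSetting.EtaleThetaData.DoubleUnderline.contH1_conj_one]
    exact hmk⟩

namespace EtaleLevels

/-! ## §A. The stage-2 model `modelχq p i j` (every `i`, even `j`): four interface / origin binders SUPPLIED -/

section StageTwo

variable (p : ℕ) [Fact p.Prime] (i j : ℤ) (hj : Even j)
  {E : (ThetaSetting.modelχq p i j hj).EtaleThetaData} {l : ℕ} (C : E.DoubleUnderline l)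
  (hC : (ThetaSetting.modelχq p i j hj).Compat) (hS : (ThetaSetting.modelχq p i j hj).Sec2Hyps)
  (hl : l.Prime) (hp2 : p ≠ 2) (hpl : p ≠ l) (hζ : ∃ ζ : (ThetaSetting.modelχq p i j hj).K, IsPrimitiveRoot ζ (4 * l))
  {Es : Set ℕ+} (τ : (ThetaSetting.modelχq p i j hj).CyclotomeTower l Es)
  (f : contCocycles (ThetaSetting.modelχq p i j hj).toTheta (ThetaSetting.modelχq p i j hj).DeltaTheta C.GtpYdduu)
  (hf : f ∈ C.rootCocycles hC)

/-- **[IUTchII] Prop. 1.5 (i)′ over `ℕ≥1` for the model family AT THE STAGE-2 MODEL `modelχq p i j`** — abc-iut-L2-t10's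
`prop15_i'_of_cyclotomeTower_of_facts` with `hslimX`, `haugOpen`, `IsEtThOrigin`, `hYcl` SUPPLIED by the stage-2 theorems;
residual inputs: Prop. 1.5 (ii), (iii) of [EtTh] §1, the cusp labels, Cor. 2.18 (i) at the chain levels,
`ThetaEnvTower.Cor219_iii`. [claim: Mochizuki2012, status: disputed] (IUTchII §1 Prop 1.5 (i), kurims p.29)
[cite: MochizukiEtTh2009, Cor 2.19(ii) p.64] -/
theorem prop15_i'_of_cyclotomeTower_modelχq
    (h15 : Literature.AnabelianGeometry.EtaleTheta.ThetaSetting.Prop15iii E hC)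
    (h15ii : Literature.AnabelianGeometry.EtaleTheta.ThetaSetting.Prop15ii E.toKummerData hC)
    (L : C.CuspLabels)
    (h218i : ∀ e : Es, (C.rigidData (τ.mod e) hC hS h15 L).Cor218_i)
    (h219iii : (C.thetaEnvTower τ hC hS).Cor219_iii)
    (A B : MonoThetaProjSystem (modelFamily C hC hS hl hp2 hpl hζ τ.modAll f hf)) :
    Literature.IUT.HodgeArakelov.Prop15_i'
      (reductions C hC hS hl hp2 hpl hζ τ.modAll f hf τ.red_modAll (isSlimGroup_PiTpχq p i j)) A B :=
  prop15_i'_of_cyclotomeTower_of_facts C hC hS hl hp2 hpl hζ τ f hf (isSlimGroup_PiTpχq p i j)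
    (isOpenMap_aug_modelχq p i j hj) h15 h15ii L h218i h219iii (ThetaSetting.modelχq_isEtThOrigin p i j hj)
    (hYcl_modelχq p i j hj) A B

/-- **[IUTchII] Prop. 1.5 (ii) for the NATURAL system AT THE STAGE-2 MODEL** — abc-iut-L2-t10's
`transitionsAreIsos_modelSystem_of_origin` with `IsEtThOrigin`, `hYcl` SUPPLIED; residual inputs: Prop. 1.5 (ii), (iii),
`L`, Cor. 2.18 (i) at the chain levels, `ThetaEnvTower.Cor219_iii`.
[claim: Mochizuki2012, status: disputed] (IUTchII §1 Prop 1.5 (ii), kurims p.29) [cite: MochizukiEtTh2009, Cor 2.18(iv) p.61] -/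
theorem transitionsAreIsos_modelSystem_modelχq
    (h15 : Literature.AnabelianGeometry.EtaleTheta.ThetaSetting.Prop15iii E hC)
    (h15ii : Literature.AnabelianGeometry.EtaleTheta.ThetaSetting.Prop15ii E.toKummerData hC)
    (L : C.CuspLabels)
    (h218i : ∀ e : Es, (C.rigidData (τ.mod e) hC hS h15 L).Cor218_i)
    (h219iii : (C.thetaEnvTower τ hC hS).Cor219_iii) :
    (modelSystem C hC hS hl hp2 hpl hζ τ.modAll f hf τ.red_modAll h15 L (fun M =>
      ModelCyclotomes.nonempty_lDeltaQuot_rigidData_mulEquiv_zHat C (τ.modAll M) hC hS h15 L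
        (ThetaSetting.modelχq_isEtThOrigin p i j hj) (hYcl_modelχq p i j hj) hl.ne_zero)).transitionsAreIsos :=
  transitionsAreIsos_modelSystem_of_origin C hC hS hl hp2 hpl hζ τ f hf h15 h15ii L h218i h219iii
    (ThetaSetting.modelχq_isEtThOrigin p i j hj) (hYcl_modelχq p i j hj)

/-- **[IUTchII] Prop. 1.5 (i) in the PRINTED form AT THE STAGE-2 MODEL** ("uniquely determined, up to isomorphism, by
`X̲̲_k`"): every compatible projective system over the model family is isomorphic to the NATURAL system — abc-iut-L2-t10's
`prop15_i_modelSystem_of_origin` with `hslimX`, `haugOpen`, `IsEtThOrigin`, `hYcl` SUPPLIED.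
[claim: Mochizuki2012, status: disputed] (IUTchII §1 Prop 1.5 (i), kurims p.29) [cite: MochizukiEtTh2009, Cor 2.19(ii) p.64] -/
theorem prop15_i_modelSystem_modelχq
    (h15 : Literature.AnabelianGeometry.EtaleTheta.ThetaSetting.Prop15iii E hC)
    (h15ii : Literature.AnabelianGeometry.EtaleTheta.ThetaSetting.Prop15ii E.toKummerData hC)
    (L : C.CuspLabels)
    (h218i : ∀ e : Es, (C.rigidData (τ.mod e) hC hS h15 L).Cor218_i)
    (h219iii : (C.thetaEnvTower τ hC hS).Cor219_iii)
    (B : MonoThetaProjSystem (modelFamily C hC hS hl hp2 hpl hζ τ.modAll f hf))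
    (hB : B.IsMonoThetaCompatible
      (reductions C hC hS hl hp2 hpl hζ τ.modAll f hf τ.red_modAll (isSlimGroup_PiTpχq p i j))) :
    Prop15_i (modelSystem C hC hS hl hp2 hpl hζ τ.modAll f hf τ.red_modAll h15 L (fun M =>
      ModelCyclotomes.nonempty_lDeltaQuot_rigidData_mulEquiv_zHat C (τ.modAll M) hC hS h15 L
        (ThetaSetting.modelχq_isEtThOrigin p i j hj) (hYcl_modelχq p i j hj) hl.ne_zero)) B :=
  prop15_i_modelSystem_of_origin C hC hS hl hp2 hpl hζ τ f hf (isSlimGroup_PiTpχq p i j)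
    (isOpenMap_aug_modelχq p i j hj) h15 h15ii L h218i h219iii (ThetaSetting.modelχq_isEtThOrigin p i j hj)
    (hYcl_modelχq p i j hj) B hB

/-- `prop15_i_modelSystem_modelχq` with the natural system on the RIGHT, the system's input "`(l·Δ_Θ)(M) ≅ Ẑ`" kept as
a binder `hZ` (abc-iut-L2-t10's `prop15_i_modelSystem_of_facts_symm` at the stage-2 model).
[claim: Mochizuki2012, status: disputed] (IUTchII §1 Prop 1.5 (i), kurims p.29) [cite: MochizukiEtTh2009, Cor 2.19(ii) p.64] -/
theorem prop15_i_modelSystem_modelχq_symm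
    (h15 : Literature.AnabelianGeometry.EtaleTheta.ThetaSetting.Prop15iii E hC)
    (h15ii : Literature.AnabelianGeometry.EtaleTheta.ThetaSetting.Prop15ii E.toKummerData hC)
    (L : C.CuspLabels)
    (hZ : ∀ M : ℕ+, Nonempty (ModelCyclotomes.lDeltaQuot (C.rigidData (τ.modAll M) hC hS h15 L) ≃*
      Literature.IUT.HodgeTheaters.ZHat))
    (h218i : ∀ e : Es, (C.rigidData (τ.mod e) hC hS h15 L).Cor218_i)
    (h219iii : (C.thetaEnvTower τ hC hS).Cor219_iii)
    (B : MonoThetaProjSystem (modelFamily C hC hS hl hp2 hpl hζ τ.modAll f hf))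
    (hB : B.IsMonoThetaCompatible
      (reductions C hC hS hl hp2 hpl hζ τ.modAll f hf τ.red_modAll (isSlimGroup_PiTpχq p i j))) :
    Prop15_i B (modelSystem C hC hS hl hp2 hpl hζ τ.modAll f hf τ.red_modAll h15 L hZ) :=
  prop15_i_modelSystem_of_facts_symm C hC hS hl hp2 hpl hζ τ f hf (isSlimGroup_PiTpχq p i j)
    (isOpenMap_aug_modelχq p i j hj) h15 h15ii L hZ h218i h219iii (ThetaSetting.modelχq_isEtThOrigin p i j hj)
    (hYcl_modelχq p i j hj) B hB

/-- **[IUTchII] Prop. 1.5 (i) (printed form) ∧ (ii) for the NATURAL projective system of model mono-theta environments of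
`X̲̲` over `ℕ≥1` AT THE STAGE-2 MODEL `modelχq p i j`**, modulo ONE residual binder list — Prop. 1.5 (ii), (iii) of [EtTh]
§1, the cusp labels, [EtTh] Cor. 2.18 (i) at every chain level, `ThetaEnvTower.Cor219_iii` — the four interface / origin
binders of abc-iut-L2-t10's `prop15_modelSystem_of_origin` being THEOREMS at `modelχq`.
[claim: Mochizuki2012, status: disputed] (IUTchII §1 Prop 1.5, kurims p.29) [cite: MochizukiEtTh2009, Cor 2.19(ii) p.64] -/
theorem prop15_modelSystem_modelχq
    (h15 : Literature.AnabelianGeometry.EtaleTheta.ThetaSetting.Prop15iii E hC)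
    (h15ii : Literature.AnabelianGeometry.EtaleTheta.ThetaSetting.Prop15ii E.toKummerData hC)
    (L : C.CuspLabels)
    (h218i : ∀ e : Es, (C.rigidData (τ.mod e) hC hS h15 L).Cor218_i)
    (h219iii : (C.thetaEnvTower τ hC hS).Cor219_iii) :
    (modelSystem C hC hS hl hp2 hpl hζ τ.modAll f hf τ.red_modAll h15 L (fun M =>
      ModelCyclotomes.nonempty_lDeltaQuot_rigidData_mulEquiv_zHat C (τ.modAll M) hC hS h15 L
        (ThetaSetting.modelχq_isEtThOrigin p i j hj) (hYcl_modelχq p i j hj) hl.ne_zero)).transitionsAreIsos ∧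
    ∀ (B : MonoThetaProjSystem (modelFamily C hC hS hl hp2 hpl hζ τ.modAll f hf)),
      B.IsMonoThetaCompatible
        (reductions C hC hS hl hp2 hpl hζ τ.modAll f hf τ.red_modAll (isSlimGroup_PiTpχq p i j)) →
      Prop15_i (modelSystem C hC hS hl hp2 hpl hζ τ.modAll f hf τ.red_modAll h15 L (fun M =>
        ModelCyclotomes.nonempty_lDeltaQuot_rigidData_mulEquiv_zHat C (τ.modAll M) hC hS h15 L
          (ThetaSetting.modelχq_isEtThOrigin p i j hj) (hYcl_modelχq p i j hj) hl.ne_zero)) B :=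
  prop15_modelSystem_of_origin C hC hS hl hp2 hpl hζ τ f hf (isSlimGroup_PiTpχq p i j)
    (isOpenMap_aug_modelχq p i j hj) h15 h15ii L h218i h219iii (ThetaSetting.modelχq_isEtThOrigin p i j hj)
    (hYcl_modelχq p i j hj)

end StageTwo

/-! ## §B. The Tate instance `modelTate p = modelχq p 1 2`, section datum of ANY Galois section: SIX binders SUPPLIED -/

section TateSection

variable (p : ℕ) [Fact p.Prime]
  (s : GQp p →* (ThetaSetting.modelTate p).PiTemp) (hs : Continuous s)
  (hsec : ∀ σ : GQp p, (ThetaSetting.modelTate p).aug (s σ) = σ)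
  (hsY : (ThetaSetting.modelTate p).GK.map s ≤ (ThetaSetting.modelTate p).GtpY)
  (hsYdd : (ThetaSetting.modelTate p).GKdd.map s ≤ (ThetaSetting.modelTate p).GtpYdd)
  (hC : (ThetaSetting.modelTate p).Compat) {l : ℕ}
  (C : (((kummerCoreχq p 1 2 even_two).toKummerDataOfSection s hs hsec hsY hsYdd).etaleThetaDataOfClass
    (etaDdχq p 1 2 even_two)).DoubleUnderline l)
  (hl : l.Prime) (hp2 : p ≠ 2) (hpl : p ≠ l) (hζ : ∃ ζ : (ThetaSetting.modelTate p).K, IsPrimitiveRoot ζ (4 * l))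
  {Es : Set ℕ+} (τ : (ThetaSetting.modelTate p).CyclotomeTower l Es)
  (f : contCocycles (ThetaSetting.modelTate p).toTheta (ThetaSetting.modelTate p).DeltaTheta C.GtpYdduu)
  (hf : f ∈ C.rootCocycles hC)

/-- **[IUTchII] Prop. 1.5 (i)′ at the section datum `E_s` of the Tate instance** — [EtTh] Prop. 1.5 (iii) (`h15`) and
Prop. 1.5 (ii) (`h15ii`) DISCHARGED by abc-iut-L2's stage-2 theorems, on top of the four §A binders; residual inputs for
every `X̲̲`-choice `C` over `E_s`: the cusp labels, Cor. 2.18 (i) at the chain levels, `ThetaEnvTower.Cor219_iii`.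
[claim: Mochizuki2012, status: disputed] (IUTchII §1 Prop 1.5 (i), kurims p.29) [cite: MochizukiEtTh2009, Cor 2.19(ii) p.64] -/
theorem prop15_i'_of_cyclotomeTower_modelTate (L : C.CuspLabels)
    (h218i : ∀ e : Es, (C.rigidData (τ.mod e) hC (ThetaSetting.modelχq_sec2Hyps p 1 2 even_two)
      (prop15iii_etaleThetaDataOfClass_etaDdχq p hC s hs hsec hsY hsYdd) L).Cor218_i)
    (h219iii : (C.thetaEnvTower τ hC (ThetaSetting.modelχq_sec2Hyps p 1 2 even_two)).Cor219_iii)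
    (A B : MonoThetaProjSystem (modelFamily C hC (ThetaSetting.modelχq_sec2Hyps p 1 2 even_two) hl hp2 hpl hζ
      τ.modAll f hf)) :
    Literature.IUT.HodgeArakelov.Prop15_i'
      (reductions C hC (ThetaSetting.modelχq_sec2Hyps p 1 2 even_two) hl hp2 hpl hζ τ.modAll f hf τ.red_modAll
        (isSlimGroup_PiTpχq p 1 2)) A B :=
  prop15_i'_of_cyclotomeTower_modelχq p 1 2 even_two C hC (ThetaSetting.modelχq_sec2Hyps p 1 2 even_two) hl hp2 hpl hζ
    τ f hf (prop15iii_etaleThetaDataOfClass_etaDdχq p hC s hs hsec hsY hsYdd)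
    (prop13_prop15_sectionData_modelTate p s hs hsec hsY hsYdd hC).2.2.1 L h218i h219iii A B

/-- **[IUTchII] Prop. 1.5 (i) (printed form) ∧ (ii) for the NATURAL system at the section datum `E_s` of the Tate
instance** — SIX binders of abc-iut-L2-t10's `prop15_modelSystem_of_origin` SUPPLIED (`hslimX`, `haugOpen`, `IsEtThOrigin`,
`hYcl`, [EtTh] Prop. 1.5 (iii) `h15`, Prop. 1.5 (ii) `h15ii`); residual for every `X̲̲`-choice `C` over `E_s` = {cusp
labels `L`, Cor. 2.18 (i) at the chain levels, `ThetaEnvTower.Cor219_iii`} (+ side conditions `hl hp2 hpl hζ`, data `τ f`).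
[claim: Mochizuki2012, status: disputed] (IUTchII §1 Prop 1.5, kurims p.29) [cite: MochizukiEtTh2009, Cor 2.19(ii) p.64] -/
theorem prop15_modelSystem_modelTate_ofSection (L : C.CuspLabels)
    (h218i : ∀ e : Es, (C.rigidData (τ.mod e) hC (ThetaSetting.modelχq_sec2Hyps p 1 2 even_two)
      (prop15iii_etaleThetaDataOfClass_etaDdχq p hC s hs hsec hsY hsYdd) L).Cor218_i)
    (h219iii : (C.thetaEnvTower τ hC (ThetaSetting.modelχq_sec2Hyps p 1 2 even_two)).Cor219_iii) :
    (modelSystem C hC (ThetaSetting.modelχq_sec2Hyps p 1 2 even_two) hl hp2 hpl hζ τ.modAll f hf τ.red_modAll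
      (prop15iii_etaleThetaDataOfClass_etaDdχq p hC s hs hsec hsY hsYdd) L (fun M =>
      ModelCyclotomes.nonempty_lDeltaQuot_rigidData_mulEquiv_zHat C (τ.modAll M) hC
        (ThetaSetting.modelχq_sec2Hyps p 1 2 even_two) (prop15iii_etaleThetaDataOfClass_etaDdχq p hC s hs hsec hsY hsYdd)
        L (ThetaSetting.modelχq_isEtThOrigin p 1 2 even_two) (hYcl_modelχq p 1 2 even_two) hl.ne_zero)).transitionsAreIsos ∧
    ∀ (B : MonoThetaProjSystem (modelFamily C hC (ThetaSetting.modelχq_sec2Hyps p 1 2 even_two) hl hp2 hpl hζ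
        τ.modAll f hf)),
      B.IsMonoThetaCompatible
        (reductions C hC (ThetaSetting.modelχq_sec2Hyps p 1 2 even_two) hl hp2 hpl hζ τ.modAll f hf τ.red_modAll
          (isSlimGroup_PiTpχq p 1 2)) →
      Prop15_i (modelSystem C hC (ThetaSetting.modelχq_sec2Hyps p 1 2 even_two) hl hp2 hpl hζ τ.modAll f hf τ.red_modAll
        (prop15iii_etaleThetaDataOfClass_etaDdχq p hC s hs hsec hsY hsYdd) L (fun M =>
        ModelCyclotomes.nonempty_lDeltaQuot_rigidData_mulEquiv_zHat C (τ.modAll M) hC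
          (ThetaSetting.modelχq_sec2Hyps p 1 2 even_two) (prop15iii_etaleThetaDataOfClass_etaDdχq p hC s hs hsec hsY hsYdd)
          L (ThetaSetting.modelχq_isEtThOrigin p 1 2 even_two) (hYcl_modelχq p 1 2 even_two) hl.ne_zero)) B :=
  prop15_modelSystem_modelχq p 1 2 even_two C hC (ThetaSetting.modelχq_sec2Hyps p 1 2 even_two) hl hp2 hpl hζ τ f hf
    (prop15iii_etaleThetaDataOfClass_etaDdχq p hC s hs hsec hsY hsYdd)
    (prop13_prop15_sectionData_modelTate p s hs hsec hsY hsYdd hC).2.2.1 L h218i h219iii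

end TateSection

/-! ## §C. CLOSED at the Galois factor `inr`, the `X̲̲` of record and the empty cusp labelling: residual = Cor. 2.18 (i), Cor. 2.19 (iii) -/

section TateClosed

variable (p : ℕ) [Fact p.Prime] (l : ℕ+) (hlo : Odd (l : ℕ))
  (hl : (l : ℕ).Prime) (hp2 : p ≠ 2) (hpl : p ≠ l) (hζ : ∃ ζ : (ThetaSetting.modelTate p).K, IsPrimitiveRoot ζ (4 * l))
  {Es : Set ℕ+} (τ : (ThetaSetting.modelTate p).CyclotomeTower l Es)

/-- **[IUTchII] Prop. 1.5 (i) (printed form) ∧ (ii) for the NATURAL system of the `X̲̲` OF RECORD over the Tate instance**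
(section `inr`, class `η̈♯`, `X̲̲ := Huuχq` via `doubleUnderlineχqOfEtaRes`, EMPTY cusp labelling): SEVEN binders of the model
discharge SUPPLIED — the only residual hypotheses are [EtTh] Cor. 2.18 (i) at the chain levels (`h218i`, FACT-LIST F-0620 =
the [EtTh] Thm. 1.6 (i)-class input) and `ThetaEnvTower.Cor219_iii` (`h219iii`), for every compatible cyclotome tower `τ`
and every root cocycle `f` (which exist: `modelχq_nonempty_cyclotomeTower`, `rootCocycles_nonempty`), under the side
conditions `l` odd prime, `p ≠ 2`, `p ≠ l`, `ζ_{4l} ∈ K = ℚ_p`.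
[claim: Mochizuki2012, status: disputed] (IUTchII §1 Prop 1.5, kurims p.29) [cite: MochizukiEtTh2009, Cor 2.19(ii) p.64] -/
theorem prop15_modelSystem_modelTate
    (f : contCocycles (ThetaSetting.modelTate p).toTheta (ThetaSetting.modelTate p).DeltaTheta
      ((((kummerCoreχq p 1 2 even_two).toKummerDataOfSection SemidirectProduct.inr (continuous_inrχq p 1 2)
        (fun _ => rfl) (map_inr_GK_le_GtpY_modelχq' p 1 2 even_two)
        (map_inr_GKdd_le_GtpYdd_modelχq' p 1 2 even_two)).etaleThetaDataOfClass
        (etaDdχq p 1 2 even_two)).doubleUnderlineχqOfEtaRes p 1 2 l hlo (eta_res_etaDdχq p 1 2 even_two l hlo)).GtpYdduu)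
    (hf : f ∈ ((((kummerCoreχq p 1 2 even_two).toKummerDataOfSection SemidirectProduct.inr (continuous_inrχq p 1 2)
        (fun _ => rfl) (map_inr_GK_le_GtpY_modelχq' p 1 2 even_two)
        (map_inr_GKdd_le_GtpYdd_modelχq' p 1 2 even_two)).etaleThetaDataOfClass
        (etaDdχq p 1 2 even_two)).doubleUnderlineχqOfEtaRes p 1 2 l hlo (eta_res_etaDdχq p 1 2 even_two l hlo)).rootCocycles
      (compat_modelχq p 1 2 even_two))
    (h218i : ∀ e : Es, (((((kummerCoreχq p 1 2 even_two).toKummerDataOfSection SemidirectProduct.inr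
        (continuous_inrχq p 1 2) (fun _ => rfl) (map_inr_GK_le_GtpY_modelχq' p 1 2 even_two)
        (map_inr_GKdd_le_GtpYdd_modelχq' p 1 2 even_two)).etaleThetaDataOfClass
        (etaDdχq p 1 2 even_two)).doubleUnderlineχqOfEtaRes p 1 2 l hlo (eta_res_etaDdχq p 1 2 even_two l hlo)).rigidData
        (τ.mod e) (compat_modelχq p 1 2 even_two) (ThetaSetting.modelχq_sec2Hyps p 1 2 even_two)
        (prop15iii_etaleThetaDataOfClass_etaDdχq p (compat_modelχq p 1 2 even_two) SemidirectProduct.inr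
          (continuous_inrχq p 1 2) (fun _ => rfl) (map_inr_GK_le_GtpY_modelχq' p 1 2 even_two)
          (map_inr_GKdd_le_GtpYdd_modelχq' p 1 2 even_two))
        ⟨fun _ => ∅, fun _ => ∅, fun _ => rfl⟩).Cor218_i)
    (h219iii : (((((kummerCoreχq p 1 2 even_two).toKummerDataOfSection SemidirectProduct.inr
        (continuous_inrχq p 1 2) (fun _ => rfl) (map_inr_GK_le_GtpY_modelχq' p 1 2 even_two)
        (map_inr_GKdd_le_GtpYdd_modelχq' p 1 2 even_two)).etaleThetaDataOfClass
        (etaDdχq p 1 2 even_two)).doubleUnderlineχqOfEtaRes p 1 2 l hlo (eta_res_etaDdχq p 1 2 even_two l hlo)).thetaEnvTower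
        τ (compat_modelχq p 1 2 even_two) (ThetaSetting.modelχq_sec2Hyps p 1 2 even_two)).Cor219_iii) :
    let E := ((kummerCoreχq p 1 2 even_two).toKummerDataOfSection SemidirectProduct.inr (continuous_inrχq p 1 2)
        (fun _ => rfl) (map_inr_GK_le_GtpY_modelχq' p 1 2 even_two)
        (map_inr_GKdd_le_GtpYdd_modelχq' p 1 2 even_two)).etaleThetaDataOfClass (etaDdχq p 1 2 even_two)
    let C := E.doubleUnderlineχqOfEtaRes p 1 2 l hlo (eta_res_etaDdχq p 1 2 even_two l hlo)
    let hC := compat_modelχq p 1 2 even_two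
    let hS := ThetaSetting.modelχq_sec2Hyps p 1 2 even_two
    let h15 := prop15iii_etaleThetaDataOfClass_etaDdχq p hC SemidirectProduct.inr (continuous_inrχq p 1 2)
        (fun _ => rfl) (map_inr_GK_le_GtpY_modelχq' p 1 2 even_two) (map_inr_GKdd_le_GtpYdd_modelχq' p 1 2 even_two)
    let L : C.CuspLabels := ⟨fun _ => ∅, fun _ => ∅, fun _ => rfl⟩
    (modelSystem C hC hS hl hp2 hpl hζ τ.modAll f hf τ.red_modAll h15 L (fun M =>
      ModelCyclotomes.nonempty_lDeltaQuot_rigidData_mulEquiv_zHat C (τ.modAll M) hC hS h15 L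
        (ThetaSetting.modelχq_isEtThOrigin p 1 2 even_two) (hYcl_modelχq p 1 2 even_two) hl.ne_zero)).transitionsAreIsos ∧
    ∀ (B : MonoThetaProjSystem (modelFamily C hC hS hl hp2 hpl hζ τ.modAll f hf)),
      B.IsMonoThetaCompatible (reductions C hC hS hl hp2 hpl hζ τ.modAll f hf τ.red_modAll (isSlimGroup_PiTpχq p 1 2)) →
      Prop15_i (modelSystem C hC hS hl hp2 hpl hζ τ.modAll f hf τ.red_modAll h15 L (fun M =>
        ModelCyclotomes.nonempty_lDeltaQuot_rigidData_mulEquiv_zHat C (τ.modAll M) hC hS h15 L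
          (ThetaSetting.modelχq_isEtThOrigin p 1 2 even_two) (hYcl_modelχq p 1 2 even_two) hl.ne_zero)) B :=
  prop15_modelSystem_modelTate_ofSection p SemidirectProduct.inr (continuous_inrχq p 1 2) (fun _ => rfl)
    (map_inr_GK_le_GtpY_modelχq' p 1 2 even_two) (map_inr_GKdd_le_GtpYdd_modelχq' p 1 2 even_two)
    (compat_modelχq p 1 2 even_two) _ hl hp2 hpl hζ τ f hf _ h218i h219iii

end TateClosed

end EtaleLevels

end Literature.IUT.HodgeArakelov

end
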